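import Summits.QuantumFields.YangMills.Theorems.BalabanUVNodesN19JacksonKernelMean
import Summits.QuantumFields.YangMills.Theorems.BalabanUVNodesN19FejerSteklovSmoothing

/-!
# YM-DAG node N19 (= NE7 proper) — JACKSON–STEKLOV SMOOTHING OF A PERIODIC LIPSCHITZ FUNCTION (the log-free smoothing package)
# (a trigonometric link within `Λ(δ + 3π⁵∕(32L))` with `|g′| ≤ Λ` and Taylor remainder `(Λ∕δ)(u − a)²` — module 150b's package with the Jackson kernel)

Cell `pub-ymgap`, HUMAN RULING D-0062 (Track A) ∕ D-0149 (work-bound push), R141 (C) wider-strategy seat `pub-ymgap-dag-n19-e` (strategy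
s3 = ALTERNATIVE CURRENCY), generation g33, module 19 (lineage module 166).  Route `Summits/QuantumFields/YangMills/Theses/BalabanUVNodes.lean`,
cluster item K3⁸ «SpineGivenEndpointR13SepCoPHV» (stmt-QuantumFields-27366); filed `--supports` that item `--as helper` (it proves no registered
stub).  COUNT-NEUTRAL: [folklore] over Mathlib and the lineage BY NAME — module 165 `…N19JacksonKernelMean` (`jacksonMean_eq_trigSum`,
`abs_jacksonMean_sub_le`, `abs_jacksonMean_sub_jacksonMean_le`, `le_integral_fejerKernel_sq`), module 150b `…N19FejerSteklovSmoothing` (`steklov_prices`),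
module 150 (`abs_fourierCoeff_le`); no laws, no scheme object, no Theses import; NOT a discharge claim.

CONTENT.  ★★ `exists_trigLink_near_periodicLipschitz_jackson`: for `f` continuous, `2π`-periodic, `Λ`-Lipschitz with `|f| ≤ M`, `L ≥ 1`, `δ > 0`:
coefficients `α, β` and natural frequencies `ω ≤ 2L` indexed by `p ∈ ((range L × range L)²) × Bool` (the two modes `k⁺`, `k⁻` of each quadruple),
mass `Σ(|α_p| + |β_p|) ≤ π⁴ML∕8`, such that `g = Σ_p(α_p cos ω_p· + β_p sin ω_p·)` and `g₁ = Σ_p ω_p(β_p cos − α_p sin)` satisfy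
`|g(u) − g(a) − g₁(a)(u − a)| ≤ (Λ∕δ)(u − a)²`, `|g₁| ≤ Λ`, and `|g − f| ≤ Λ(δ + 3π⁵∕(32L))` — module 150b's `exists_trigLink_near_periodicLipschitz`
with `π(1 + log L)∕L` replaced by `3π⁵∕(32L)`: NO LOGARITHM.  The sequel (`…N19LipschitzLinkJacksonSmoothing` ∕ `…DegreeBudgetLogSq`) feeds it to
module 151: every Lipschitz link of `Σ|x_i|` at `C·K·d·log₂²t∕t` — `log³ → log²`.

HONEST FRAMING (binding).  Elementary and [folklore]; NO consumer in the DAG today (the seat's own currency map, degree model); nothing of Bałaban's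
instantiated; NE7 NOT PRINTED, NOT proved; N19 NOT discharged; count-neutral.  One finite `T⁴` programme at fixed `ε`; nothing continuum ∕ `ℝ⁴` ∕ OS ∕
mass-gap ∕ Clay.  0 `def` ∕ 0 `sorry`.
-/

noncomputable section

open Finset MeasureTheory intervalIntegral
open scoped Real

namespace Summit.QuantumFields.YangMills.Theorems.BalabanUVNodesN19JacksonSteklovSmoothing

open Literature.Probability.LatticeModels (fejerKernel)
open Summit.QuantumFields.YangMills.Theorems.BalabanUVNodesN19JacksonKernelMean
  (jacksonMean_eq_trigSum abs_jacksonMean_sub_le abs_jacksonMean_sub_jacksonMean_le le_integral_fejerKernel_sq)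
open Summit.QuantumFields.YangMills.Theorems.BalabanUVNodesN19FejerSteklovSmoothing (steklov_prices)
open Summit.QuantumFields.YangMills.Theorems.BalabanUVNodesN19FejerMean (abs_fourierCoeff_le)

/-! ## §1 ★★ The Jackson–Steklov smoothing of a periodic Lipschitz function [folklore] -/

/-- ★★ **JACKSON–STEKLOV SMOOTHING (log-free).**  Let `f : ℝ → ℝ` be continuous, `2π`-periodic, `Λ`-Lipschitz with `|f| ≤ M`, and let `L ≥ 1`,
`δ > 0`.  Then there are `α, β, ω` indexed by `p ∈ ((range L × range L) × (range L × range L)) × Bool` (`ω_p ∈ ℕ`, `0 ≤ ω_p ≤ 2L`,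
`Σ_p(|α_p| + |β_p|) ≤ π⁴ML∕8`) such that `g(θ) = Σ_p(α_p cos(ω_pθ) + β_p sin(ω_pθ))` and `g₁(θ) = Σ_p ω_p(β_p cos(ω_pθ) − α_p sin(ω_pθ))` satisfy
`|g(u) − g(a) − g₁(a)(u − a)| ≤ (Λ∕δ)(u − a)²`, `|g₁| ≤ Λ` and `|g(θ) − f(θ)| ≤ Λ(δ + 3π⁵∕(32L))` for all reals (`g` = the Steklov box average of
width `2δ` of the Jackson mean `(1∕Z)∫f(θ − v)f_L(v)²dv`).  Module 150b's package with NO `log L`. [folklore] -/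
theorem exists_trigLink_near_periodicLipschitz_jackson {f : ℝ → ℝ} {Λ M : ℝ} (hfc : Continuous f) (hper : Function.Periodic f (2 * π))
    (hΛ : ∀ a b, |f a - f b| ≤ Λ * |a - b|) (hM : ∀ w, |f w| ≤ M) {L : ℕ} (hL : 1 ≤ L) {δ : ℝ} (hδ : 0 < δ) :
    ∃ α β ω : ((ℕ × ℕ) × (ℕ × ℕ)) × Bool → ℝ, (∀ p, 0 ≤ ω p) ∧
      (∀ p ∈ ((range L ×ˢ range L) ×ˢ (range L ×ˢ range L)) ×ˢ (Finset.univ : Finset Bool), ω p ≤ 2 * L) ∧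
      (∑ p ∈ ((range L ×ˢ range L) ×ˢ (range L ×ˢ range L)) ×ˢ (Finset.univ : Finset Bool), (|α p| + |β p|) ≤ π ^ 4 * M * L / 8) ∧
      (∀ u a, |(∑ p ∈ ((range L ×ˢ range L) ×ˢ (range L ×ˢ range L)) ×ˢ (Finset.univ : Finset Bool),
            (α p * Real.cos (ω p * u) + β p * Real.sin (ω p * u))) -
          (∑ p ∈ ((range L ×ˢ range L) ×ˢ (range L ×ˢ range L)) ×ˢ (Finset.univ : Finset Bool),
            (α p * Real.cos (ω p * a) + β p * Real.sin (ω p * a))) -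
          (∑ p ∈ ((range L ×ˢ range L) ×ˢ (range L ×ˢ range L)) ×ˢ (Finset.univ : Finset Bool),
            ω p * (β p * Real.cos (ω p * a) - α p * Real.sin (ω p * a))) * (u - a)| ≤ Λ / δ * (u - a) ^ 2) ∧
      (∀ a, |∑ p ∈ ((range L ×ˢ range L) ×ˢ (range L ×ˢ range L)) ×ˢ (Finset.univ : Finset Bool),
          ω p * (β p * Real.cos (ω p * a) - α p * Real.sin (ω p * a))| ≤ Λ) ∧
      (∀ θ, |(∑ p ∈ ((range L ×ˢ range L) ×ˢ (range L ×ˢ range L)) ×ˢ (Finset.univ : Finset Bool),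
          (α p * Real.cos (ω p * θ) + β p * Real.sin (ω p * θ))) - f θ| ≤ Λ * (δ + 3 * π ^ 5 / (32 * L))) := by
  have hπ := Real.pi_pos
  have hLr : (0 : ℝ) < L := by exact_mod_cast hL
  have hM0 : 0 ≤ M := (abs_nonneg _).trans (hM 0)
  set Z : ℝ := ∫ v in (-π)..π, fejerKernel L v ^ 2 with hZ
  have hZlow : 32 * L / π ^ 3 ≤ Z := le_integral_fejerKernel_sq hL
  have hZ0 : 0 < Z := lt_of_lt_of_le (by positivity) hZlow
  -- the two modes of a quadruple
  set kp : (ℕ × ℕ) × (ℕ × ℕ) → ℕ := fun q => ((q.1.1 : ℤ) - q.1.2).natAbs + ((q.2.1 : ℤ) - q.2.2).natAbs with hkp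
  set km : (ℕ × ℕ) × (ℕ × ℕ) → ℕ := fun q => ((((q.1.1 : ℤ) - q.1.2).natAbs : ℤ) - ((q.2.1 : ℤ) - q.2.2).natAbs).natAbs with hkm
  set ω : ((ℕ × ℕ) × (ℕ × ℕ)) × Bool → ℝ := fun p => if p.2 then (kp p.1 : ℝ) else (km p.1 : ℝ) with hω
  set a : ((ℕ × ℕ) × (ℕ × ℕ)) × Bool → ℝ := fun p => (1 / (2 * L ^ 2 * Z)) * ∫ w in (-π)..π, f w * Real.cos (ω p * w) with ha
  set b : ((ℕ × ℕ) × (ℕ × ℕ)) × Bool → ℝ := fun p => (1 / (2 * L ^ 2 * Z)) * ∫ w in (-π)..π, f w * Real.sin (ω p * w) with hb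
  set Q : Finset ((ℕ × ℕ) × (ℕ × ℕ)) := (range L ×ˢ range L) ×ˢ (range L ×ˢ range L) with hQ
  set P : Finset (((ℕ × ℕ) × (ℕ × ℕ)) × Bool) := Q ×ˢ (Finset.univ : Finset Bool) with hP
  -- the Jackson mean as a sum over `P`
  have hT : ∀ θ, (1 / Z) * ∫ v in (-π)..π, f (θ - v) * fejerKernel L v ^ 2 =
      ∑ p ∈ P, (a p * Real.cos (ω p * θ) + b p * Real.sin (ω p * θ)) := by
    intro θ
    have hωt : ∀ q, ω (q, true) = (kp q : ℝ) := fun q => by simp [hω]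
    have hωf : ∀ q, ω (q, false) = (km q : ℝ) := fun q => by simp [hω]
    rw [jacksonMean_eq_trigSum hfc hper L Z θ, hP, Finset.sum_product (s := Q) (t := (Finset.univ : Finset Bool))]
    refine Finset.sum_congr rfl fun q _ => ?_
    rw [Fintype.sum_bool]
    simp only [ha, hb, hωt, hωf, hkp, hkm]
    ring
  have hTLip : ∀ u v, |(∑ p ∈ P, (a p * Real.cos (ω p * u) + b p * Real.sin (ω p * u))) -
      ∑ p ∈ P, (a p * Real.cos (ω p * v) + b p * Real.sin (ω p * v))| ≤ Λ * |u - v| := by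
    intro u v
    rw [← hT u, ← hT v]
    exact abs_jacksonMean_sub_jacksonMean_le hfc hΛ hL u v
  obtain ⟨h1, -, h3, h4⟩ := steklov_prices P a b ω hδ hTLip
  have hsum_g : ∀ θ, (∑ p ∈ P, (Real.sinc (ω p * δ) * a p * Real.cos (ω p * θ) + Real.sinc (ω p * δ) * b p * Real.sin (ω p * θ))) =
      ∑ p ∈ P, Real.sinc (ω p * δ) * (a p * Real.cos (ω p * θ) + b p * Real.sin (ω p * θ)) :=
    fun θ => Finset.sum_congr rfl fun p _ => by ring
  have hsum_g₁ : ∀ θ, (∑ p ∈ P, ω p * (Real.sinc (ω p * δ) * b p * Real.cos (ω p * θ) - Real.sinc (ω p * δ) * a p * Real.sin (ω p * θ))) =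
      ∑ p ∈ P, ω p * Real.sinc (ω p * δ) * (b p * Real.cos (ω p * θ) - a p * Real.sin (ω p * θ)) :=
    fun θ => Finset.sum_congr rfl fun p _ => by ring
  have hω0 : ∀ p, 0 ≤ ω p := by
    intro p; rw [hω]; show 0 ≤ (if p.2 then (kp p.1 : ℝ) else (km p.1 : ℝ)); split_ifs <;> exact Nat.cast_nonneg _
  refine ⟨fun p => Real.sinc (ω p * δ) * a p, fun p => Real.sinc (ω p * δ) * b p, ω, hω0, ?_, ?_, ?_, ?_, ?_⟩
  · -- frequencies `≤ 2L`
    intro p hp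
    rw [hP, Finset.mem_product, hQ, Finset.mem_product, Finset.mem_product, Finset.mem_product, Finset.mem_range, Finset.mem_range,
      Finset.mem_range, Finset.mem_range] at hp
    obtain ⟨⟨⟨h11, h12⟩, h21, h22⟩, -⟩ := hp
    have hkp' : kp p.1 ≤ 2 * L := by rw [hkp]; show ((p.1.1.1 : ℤ) - p.1.1.2).natAbs + ((p.1.2.1 : ℤ) - p.1.2.2).natAbs ≤ 2 * L; omega
    have hkm' : km p.1 ≤ 2 * L := by
      rw [hkm]; show ((((p.1.1.1 : ℤ) - p.1.1.2).natAbs : ℤ) - ((p.1.2.1 : ℤ) - p.1.2.2).natAbs).natAbs ≤ 2 * L; omega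
    rw [hω]
    show (if p.2 then (kp p.1 : ℝ) else (km p.1 : ℝ)) ≤ 2 * L
    split_ifs
    · exact_mod_cast hkp'
    · exact_mod_cast hkm'
  · -- mass
    have hc0 : (0 : ℝ) < 1 / (2 * L ^ 2 * Z) := by positivity
    have hcoefZ : 1 / (2 * L ^ 2 * Z) * (2 * π * M) ≤ π ^ 4 * M / (32 * L ^ 3) := by
      have h1 : 1 / (2 * L ^ 2 * Z) ≤ 1 / (2 * L ^ 2 * (32 * L / π ^ 3)) :=
        one_div_le_one_div_of_le (by positivity) (mul_le_mul_of_nonneg_left hZlow (by positivity))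
      calc 1 / (2 * L ^ 2 * Z) * (2 * π * M) ≤ 1 / (2 * L ^ 2 * (32 * L / π ^ 3)) * (2 * π * M) :=
            mul_le_mul_of_nonneg_right h1 (by positivity)
        _ = π ^ 4 * M / (32 * L ^ 3) := by field_simp
    have hcoef : ∀ p ∈ P, |Real.sinc (ω p * δ) * a p| + |Real.sinc (ω p * δ) * b p| ≤ 2 * (π ^ 4 * M / (32 * L ^ 3)) := by
      intro p _
      obtain ⟨hc, hs⟩ := abs_fourierCoeff_le hM (ω p)
      have hsinc := Real.abs_sinc_le_one (ω p * δ)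
      have hc' : |a p| ≤ π ^ 4 * M / (32 * L ^ 3) := by
        rw [ha, abs_mul (1 / (2 * L ^ 2 * Z)) _, abs_of_pos hc0]
        exact (mul_le_mul_of_nonneg_left hc hc0.le).trans hcoefZ
      have hs' : |b p| ≤ π ^ 4 * M / (32 * L ^ 3) := by
        rw [hb, abs_mul (1 / (2 * L ^ 2 * Z)) _, abs_of_pos hc0]
        exact (mul_le_mul_of_nonneg_left hs hc0.le).trans hcoefZ
      rw [abs_mul (Real.sinc _) (a p), abs_mul (Real.sinc _) (b p)]
      have e : 2 * (π ^ 4 * M / (32 * (L : ℝ) ^ 3)) = 1 * (π ^ 4 * M / (32 * L ^ 3)) + 1 * (π ^ 4 * M / (32 * L ^ 3)) := by ring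
      rw [e]
      exact add_le_add (mul_le_mul hsinc hc' (abs_nonneg _) zero_le_one) (mul_le_mul hsinc hs' (abs_nonneg _) zero_le_one)
    calc ∑ p ∈ P, (|Real.sinc (ω p * δ) * a p| + |Real.sinc (ω p * δ) * b p|) ≤ ∑ _p ∈ P, 2 * (π ^ 4 * M / (32 * L ^ 3)) :=
          Finset.sum_le_sum hcoef
      _ = (L * L * (L * L) * 2 : ℝ) * (2 * (π ^ 4 * M / (32 * L ^ 3))) := by
          simp only [sum_const, hP, hQ, Finset.card_product, Finset.card_range, Finset.card_univ, Fintype.card_bool, nsmul_eq_mul]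
          push_cast; ring
      _ = π ^ 4 * M * L / 8 := by field_simp; ring
  · intro u v
    rw [hsum_g u, hsum_g v, hsum_g₁ v]
    exact h3 u v
  · intro θ
    rw [hsum_g₁ θ]
    exact h1 θ
  · intro θ
    have hS := h4 θ
    have hF := abs_jacksonMean_sub_le hfc hΛ hL θ
    rw [hT θ] at hF
    rw [hsum_g θ]
    calc |(∑ p ∈ P, Real.sinc (ω p * δ) * (a p * Real.cos (ω p * θ) + b p * Real.sin (ω p * θ))) - f θ|
        ≤ |(∑ p ∈ P, Real.sinc (ω p * δ) * (a p * Real.cos (ω p * θ) + b p * Real.sin (ω p * θ))) -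
            ∑ p ∈ P, (a p * Real.cos (ω p * θ) + b p * Real.sin (ω p * θ))| +
          |(∑ p ∈ P, (a p * Real.cos (ω p * θ) + b p * Real.sin (ω p * θ))) - f θ| := abs_sub_le _ _ _
      _ ≤ Λ * δ + Λ * (3 * π ^ 5 / (32 * L)) := add_le_add hS hF
      _ = Λ * (δ + 3 * π ^ 5 / (32 * L)) := by ring

end Summit.QuantumFields.YangMills.Theorems.BalabanUVNodesN19JacksonSteklovSmoothing

end
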